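/-
COR-CM (cell pub-hodgecm2 = stage 2 of the Hodge ladder), seat p1 gen 14 (prover-pub-hodgecm2-p1-g14-0, 2026-08-21),
count-neutral CLAIM VAC-W for the coordinator's VACUITY/MODEL audit (operator priority5, 2026-08-21T02:09:59Z;
t0 probe `run/shared/lean/pub/hodge-director/audit-vacuity/t0.json`: «carrier-unverified: binder A :
Literature.AlgebraicGeometry.Motives.AbelianVariety ℂ — status unknown»; «no kernel witness … s_case»).  Theorems only:
no definition, no named fact, no instance; nothing about `Interfaces.lean` / `ModelChain.lean` changes; no audit verdict
is stated here (that is the auditors').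
-/
import Summits.HodgeConjecture.CorCM.Model.CMAbelianVarietyRealisedHolds
import Summits.HodgeConjecture.CorCM.Model.DimZeroDomination
import Summits.HodgeConjecture.CorCM.Assembly.ModelChain
import Summits.HodgeConjecture.HodgeConjecture.Theorems.Ring2AtlasCMSixfoldsNonVacuity
import Literature.AlgebraicGeometry.HodgeTheory.ComplexConjugationHolds
import Literature.AlgebraicGeometry.HodgeTheory.HodgeFiltrationModelsReductionProofs
import Literature.AlgebraicGeometry.HodgeTheory.AbelianVarietyHodgeFullnessHolds
import Literature.AlgebraicGeometry.HodgeTheory.DivisorClassesHardLefschetz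
import Literature.AlgebraicGeometry.HodgeTheory.AbelianLowDimensionWeilReductionProofs
import Literature.AlgebraicGeometry.HodgeTheory.LefschetzOneOneHolds
import Literature.AlgebraicGeometry.Pohlmann1968.DegenerateCMTypeCyclotomic21
import Literature.NumberTheory.Automorphic.PicardUnitaryDatumWitness
import HarnessLib

/-!
# COR-CM — the conclusion `HC_CM` of the E term: honest carrier, padding-free content, a kernel instance of
# its open content, and the E term's type reduced to its two open leaves

Kernel handles for the Hodge VACUITY/MODEL audit of the stage-2 E term
`Summit.HodgeConjecture.CorCM.hc_cm_of_PerLFace : HC_CM_of_PerLFace` (`CorCM/Assembly/ModelChain.lean`, p238778), whose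
conclusion `HC_CM` is BY NAME the route item `Theses.RankFourFaces.CMAbelianHodge`
  `∀ A : AbelianVariety ℂ, IsSmoothProjective A.dim A.X → (∃ S ≤ End⁰(A) comm. reduced, dim_ℚ S = 2 dim A) →
     HodgeConjectureFor A.dim A.X`.
Four structural traps would make that conclusion — hence the E term — true or weak for the wrong reason:

* (T1) the carrier `AbelianVariety ℂ` is empty, or no inhabitant meets the two binders (`IsSmoothProjective`,
  CM type): then `CMAbelianHodge` is a vacuous `∀`;
* (T2) the carrier is met only degenerately (dimension `≤ 3`, where the Hodge conjecture for abelian varieties is a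
  THEOREM of the tree, `hodgeConjectureFor_abelian_of_dim_le_three'`), or only by CM abelian varieties all of whose
  Hodge classes are products of divisor classes (then `HC_CM` follows from Lefschetz `(1,1)`, also a tree theorem);
* (T3) the conclusion `HodgeConjectureFor` is padded (its anti-vacuity conjunct `Nonempty (HodgeModel …)`, the
  binder `IsSmoothProjective`) so that what is asserted is unclear;
* (T4) the E term's binder prefix `∀ hHD hI h₁ h₃, PerLFace → hR → …` displays closed leaves, so that its TYPE looks
  more conditional than it is (or an uninhabited record binder would make it vacuous).

This file records, with NO hypothesis (every input is a tree theorem):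

* (T1) `exists_cmCarrier` — for EVERY CM field `K` and EVERY CM type `Φ` there is `A : AbelianVariety ℂ` meeting BOTH
  binders (`IsSmoothProjective A.dim A.X`; `Milne1999.IsOfCMType A`, the binder's `∃ S` clause by `Iff.rfl`) with
  `2 · A.dim = [K:ℚ]` — the cell's realisation theorem `cmAbelianVarietyRealised_holds` (Shimura 1998 §6.2 Thm. 3 on
  `ℂ^Φ/Φ(𝓞_K)`; `CorCM/Model/CMAbelianVarietyRealisedHolds`) read through `isOfCMType_of_isCMTypeRealisation` and
  `schemeDim_eq_holds`; `exists_cmCarrier_of_isCMField` (every CM field carries a CM type), `exists_cmCarrier_dim_three`.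
* (T2) `exists_simple_cm_sixfold` — a SIMPLE CM abelian SIXFOLD (ring 2's `exists_isSimpleCMSixfold_of_…`, now
  hypothesis-free); `cmAbelianHodge_binders_inhabited` — the literal binder prefix of `CMAbelianHodge` met in dimension
  `6`; and, decisively, `exists_simple_cm_sixfold_exceptional` — a simple CM abelian sixfold (type `(ℚ(ζ₂₁); Φ₂₁)`,
  Pohlmann 1968 §3 / van Geemen 4.5–4.7, tree `Pohlmann1968.Cyclotomic.exists_exceptional_Φ₂₁`) carrying a rational
  `(3,3)`-class OUTSIDE the span of products of divisor classes: the OPEN content of `HC_CM` is instantiated in the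
  kernel (`hc_cm_exceptional_instance`: `HC_CM` asserts that this class is algebraic — no tree theorem and no printed
  theorem says so).
* (T3) `hc_cm_iff_cycleClause` — `HC_CM` EQUALS its cycle clause (the binder `IsSmoothProjective A.dim A.X` and the
  conjunct `Nonempty (HodgeModel A.dim A.X)` are theorems: `AbelianVariety.isSmoothProjective_holds`,
  `exists_isReal_hodgeModel_holds`); `hc_cm_iff_exceptionalClause` — `HC_CM` EQUALS «every EXCEPTIONAL rational
  `(p,p)`-class (outside `Dᵖ ⊗ ℂ`) on a complex abelian variety of CM type is algebraic», such classes living only in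
  `2 ≤ p ≤ dim A − 2` (`two_le_and_add_two_le_dim_of_exceptional`; products of divisor classes are algebraic by
  Lefschetz `(1,1)`, `lefschetzOneOne_rational_holds` + `divisorClassesSpan_le_algebraicClasses`);
  `cmHodgeHypothesisAt_of_dim_le_three` — below dimension `4` the clause of `HC_CM` is a tree theorem.
* (T4) `hc_cm_of_PerLFace_iff_two_leaves` — of the six leaves of the E term's type, `hHD`, `hI`, `h₃` and `hR` are
  closed tree terms (`exists_isReal_hodgeModel_holds`, `hodgePQ_independent_of_hodgeModel_holds`,
  `cmAbelianVarietyRealised_holds`, `deligneMilne1982_Thm_6_20_full_holds`), so BY PROOF IRRELEVANCE the type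
  `HC_CM_of_PerLFace` is equivalent to `∀ h₁ : BallQuotientUniformised, (Model.picardCMUniverse ✓ ✓ h₁ ✓).PerLFace → HC_CM`:
  exactly two displayed leaves remain — the uniformisation record `h₁` (LIT-FANOUT row D4) and the face-form period
  theorem of the model universe (the stage-1 interface).  Whether `h₁` is inhabited and whether `PerLFace` of the
  model universe is satisfiable is NOT decided here (the binder prefix of `PerLFace` itself is inhabited:
  `CorCM/Geometry/NonVacuity.lean`, `periodThmF_binders_inhabited`).  `cycleClause_of_PerLFace` /
  `exceptional_algebraic_of_PerLFace` display the E term of record in these padding-free forms.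

## References

* [Shimura1998] G. Shimura, *Abelian Varieties with Complex Multiplication and Modular Functions* (1998), §6.2
  Thm. 3 (pp. 41–42), §8.4 Example (1) (p. 64), §8.2 Prop. 26 (p. 61).
* [Milne1999] J. S. Milne, *Lefschetz motives and the Tate conjecture*, Compositio Math. 117 (1999), §2 p. 54, §7 p. 72.
* [Pohlmann1968] H. Pohlmann, *Algebraic cycles on abelian varieties of complex multiplication type*, Ann. of Math.
  88 (1968), Thm. 1 and §3.
* [vanGeemen1994HodgeAV] B. van Geemen, *An introduction to the Hodge conjecture for abelian varieties*, LNM 1594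
  (1994), §2.4–2.5, Thm. 4.5, 4.7.
* [Deligne2000] P. Deligne, *The Hodge conjecture*, Clay Mathematics Institute (2000), §1.
-/

noncomputable section

namespace Summit.HodgeConjecture.CorCM

open NumberField
open Literature.AlgebraicGeometry.Motives (AbelianVariety IsSmoothProjective CMType schemeDim_eq_holds)
open Literature.AlgebraicGeometry.HodgeTheory
open Literature.AlgebraicGeometry.Milne1999 (IsOfCMType CMHodgeHypothesisAt)
open Literature.AlgebraicGeometry.ComplexMultiplication (IsCMTypeRealisation)
open Literature.NumberTheory.ComplexMultiplication (isOfCMType_of_isCMTypeRealisation)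
open Literature.NumberTheory.Automorphic.PicardCM
open Literature.Barriers.HodgeConjecture (divisorClassesSpan)
open Literature.AlgebraicGeometry.Pohlmann1968 (Cyclotomic.Φ₂₁ Cyclotomic.exists_exceptional_Φ₂₁
  Cyclotomic.isSimple_Φ₂₁ Cyclotomic.dim_eq_six)
open Summit.HodgeConjecture.HodgeConjecture.Ring2.Atlas (IsSimpleCMSixfold
  exists_isSimpleCMSixfold_of_cmAbelianVarietyRealised)

/-! ### (T1) The carrier of `HC_CM` is inhabited, in every CM type, by objects meeting both binders -/

/-- **Every CM type is carried by an honest inhabitant of the carrier of `HC_CM`.**  For every CM field `K` and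
every CM type `Φ` of `K` there is a complex abelian variety `A : AbelianVariety ℂ` (a proper, geometrically
integral `ℂ`-group scheme) which is smooth projective of dimension `A.dim` (first binder of `CMAbelianHodge`), of
CM type in Milne's étale form `IsOfCMType A` (second binder, `Iff.rfl`), with `2 · A.dim = [K:ℚ]` — namely the
algebraisation of `ℂ^Φ/Φ(𝓞_K)` delivered by `cmAbelianVarietyRealised_holds` (Shimura 1998 §6.2 Thm. 3), whose
`𝓞_K`-action makes it of CM type (`isOfCMType_of_isCMTypeRealisation`) and whose dimension is `[K:ℚ]/2`
(`schemeDim_eq_holds`).  No hypothesis. [cite: Shimura1998, §6.2 Theorem 3 (pp. 41–42)] [cite: Milne1999, §2 p. 54] -/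
theorem exists_cmCarrier (K : Type) [Field K] [NumberField K] [IsCMField K] (Φ : CMType K) :
    ∃ A : AbelianVariety ℂ, IsSmoothProjective A.dim A.X ∧ IsOfCMType A ∧ 2 * A.dim = Module.finrank ℚ K := by
  obtain ⟨A, ι, θ, hA⟩ := cmAbelianVarietyRealised_holds K Φ
  have hA' : IsCMTypeRealisation Φ A ι θ := hA
  have hdim : A.dim = Module.finrank ℚ K / 2 := schemeDim_eq_holds hA'.1
  refine ⟨A, AbelianVariety.isSmoothProjective_holds, isOfCMType_of_isCMTypeRealisation hA', ?_⟩
  have heven : Even (Module.finrank ℚ K) := by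
    rw [IsTotallyComplex.finrank (K := K)]
    exact even_two_mul _
  obtain ⟨m, hm⟩ := heven
  omega

/-- **Every CM field indexes a CM carrier of half its degree**: a CM field carries a CM type (`nonempty_cmType`:
choose one embedding in each conjugate pair), hence by `exists_cmCarrier` an abelian variety of CM type of dimension
`[K:ℚ]/2` meeting both binders of `CMAbelianHodge`. [cite: Shimura1998, §6.2 Theorem 3 (pp. 41–42)] -/
theorem exists_cmCarrier_of_isCMField (K : Type) [Field K] [NumberField K] [IsCMField K] :
    ∃ A : AbelianVariety ℂ, IsSmoothProjective A.dim A.X ∧ IsOfCMType A ∧ 2 * A.dim = Module.finrank ℚ K := by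
  obtain ⟨Φ⟩ := nonempty_cmType K
  exact exists_cmCarrier K Φ

/-- **A CM abelian threefold in the carrier**: over the cyclotomic field `ℚ(ζ₇)` (CM, degree `6`: tree
`UnitaryGroup.isCMField_cyclotomicField_seven`, `UnitaryGroup.finrank_cyclotomicField_seven`) the carrier of `HC_CM`
has an inhabitant of dimension `3` meeting both binders. [cite: Shimura1998, §6.2 Theorem 3 (pp. 41–42)] -/
theorem exists_cmCarrier_dim_three :
    ∃ A : AbelianVariety ℂ, IsSmoothProjective A.dim A.X ∧ IsOfCMType A ∧ A.dim = 3 := by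
  obtain ⟨A, hsp, hcm, hdim⟩ := exists_cmCarrier_of_isCMField (CyclotomicField.{0} 7 ℚ)
  refine ⟨A, hsp, hcm, ?_⟩
  have h6 := Literature.NumberTheory.Automorphic.UnitaryGroup.finrank_cyclotomicField_seven
  omega

/-! ### (T2) Non-degenerate inhabitants: a simple CM sixfold, and one with an exceptional Hodge class -/

/-- **A SIMPLE CM abelian SIXFOLD exists — unconditionally.**  Ring 2's non-vacuity theorem for its atlas row
`g = 6`, simple, CM-type (`exists_isSimpleCMSixfold_of_cmAbelianVarietyRealised`: any realisation of Shimura's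
primitive cyclotomic CM type `(ℚ(ζ₁₃); {φ₁,…,φ₆})`, simple by §8.2 Prop. 26) took the realisation record
`PicardCM.CMAbelianVarietyRealised` as a hypothesis; that record is the tree theorem `cmAbelianVarietyRealised_holds`
of this cell, so the class `IsSimpleCMSixfold A := A.dim = 6 ∧ A.IsSimple ∧ IsOfCMType A` is inhabited outright.
[cite: Shimura1998, §8.4 Example (1), p. 64; §8.2 Prop. 26, p. 61; §6.2 Thm. 3] -/
theorem exists_simple_cm_sixfold : ∃ A : AbelianVariety ℂ, IsSimpleCMSixfold A :=
  exists_isSimpleCMSixfold_of_cmAbelianVarietyRealised cmAbelianVarietyRealised_holds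

/-- **The literal binder prefix of `CMAbelianHodge` is met in dimension `6`** — symbol for symbol the two
hypotheses of the route item `stmt-HodgeConjecture-3052` (smooth projective of dimension `A.dim`; a commutative
reduced `ℚ`-subalgebra of `End⁰(A) = A.endAlgebra` of dimension `2 · A.dim`), at an abelian variety of dimension `6`:
the conclusion `HC_CM` of the E term is not a `∀` over an empty or degenerate domain. [cite: Milne1999, §2 p. 54] -/
theorem cmAbelianHodge_binders_inhabited :
    ∃ A : AbelianVariety ℂ, A.dim = 6 ∧ IsSmoothProjective A.dim A.X ∧
      ∃ S : Subalgebra ℚ A.endAlgebra, IsReduced ↥S ∧ (∀ x ∈ S, ∀ y ∈ S, x * y = y * x) ∧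
        Module.finrank ℚ ↥S = 2 * A.dim := by
  obtain ⟨A, hdim, -, hcm⟩ := exists_simple_cm_sixfold
  exact ⟨A, hdim, AbelianVariety.isSmoothProjective_holds, hcm⟩

/-- **A simple CM abelian sixfold WITH AN EXCEPTIONAL HODGE CLASS exists — unconditionally.**  A realisation `A`
of the primitive, degenerate CM type `(ℚ(ζ₂₁); Φ₂₁)` (tree `Pohlmann1968.Cyclotomic.Φ₂₁`; `ℚ(√-3) ⊂ ℚ(ζ₂₁)` acts with
multiplicities `(3,3)`) — which EXISTS by `cmAbelianVarietyRealised_holds` — is simple (`isSimple_Φ₂₁`, Shimura §8.2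
Prop. 26), of dimension `6` (`dim_eq_six`), of CM type (`isOfCMType_of_isCMTypeRealisation`), and carries a rational
class of Hodge type `(3,3)` in `H⁶(A(ℂ); ℂ)` lying OUTSIDE the span `D³ ⊗ ℂ` of triple products of divisor classes
(`exists_exceptional_Φ₂₁`: Pohlmann's criterion, van Geemen Thm. 4.5/4.7 — the dimension-`6` cyclotomic analogue of
Mumford's simple CM fourfolds).  So the OPEN content of `HC_CM` (`hc_cm_iff_exceptionalClause`) has a kernel
inhabitant: neither Lefschetz `(1,1)` nor the low-dimension theorems decide the algebraicity of this class.
[cite: Pohlmann1968, Thm. 1 and §3] [cite: vanGeemen1994HodgeAV, Thm. 4.5 and 4.7] [cite: Shimura1998, §6.2 Theorem 3; §8.2 Prop. 26] -/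
theorem exists_simple_cm_sixfold_exceptional :
    ∃ A : AbelianVariety ℂ, A.IsSimple ∧ A.dim = 6 ∧ IsOfCMType A ∧
      ∃ c : complexBetti A.X (2 * 3), IsRationalClass c ∧ IsOfHodgeType A.dim A.X (2 * 3) 3 3 c ∧
        c ∉ divisorClassesSpan A.X A.dim 3 := by
  haveI : IsCyclotomicExtension {21} ℚ (CyclotomicField 21 ℚ) := CyclotomicField.isCyclotomicExtension 21 ℚ
  haveI : NumberField (CyclotomicField 21 ℚ) := IsCyclotomicExtension.numberField {21} ℚ _
  haveI : IsCMField (CyclotomicField 21 ℚ) :=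
    IsCyclotomicExtension.Rat.isCMField (CyclotomicField 21 ℚ) (S := {21}) ⟨21, rfl, by norm_num⟩
  obtain ⟨A, ι, θ, hA⟩ := cmAbelianVarietyRealised_holds (CyclotomicField 21 ℚ) (Cyclotomic.Φ₂₁ _)
  have hA' : IsCMTypeRealisation (Cyclotomic.Φ₂₁ _) A ι θ := hA
  have h6 : A.dim = 6 := Cyclotomic.dim_eq_six hA'
  refine ⟨A, Cyclotomic.isSimple_Φ₂₁ hA', h6, isOfCMType_of_isCMTypeRealisation hA', ?_⟩
  rw [h6]
  exact Cyclotomic.exists_exceptional_Φ₂₁ hA'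

/-! ### (T3) `HC_CM` with its padding removed -/

/-- **What `HC_CM` asserts.**  The first binder `IsSmoothProjective A.dim A.X` of `CMAbelianHodge` holds for EVERY
abelian variety (`AbelianVariety.isSmoothProjective_holds`: abelian varieties are projective, Mumford §6 App. 1,
Görtz–Wedhorn II 27.174), and the anti-vacuity conjunct `Nonempty (HodgeModel A.dim A.X)` of `HodgeConjectureFor`
holds for every smooth projective variety (`exists_isReal_hodgeModel_holds`: GAGA, de Rham, Hodge decomposition).
Hence `HC_CM` (= `CMAbelianHodge`, by name) is EQUIVALENT to its cycle clause: for every complex abelian variety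
of CM type, every `p` and every class `c ∈ H^{2p}(A(ℂ); ℂ)` that is rational and of Hodge type `(p,p)`, `c` lies in
the span `algebraicClasses A.X p` of classes of codimension-`p` algebraic cycles.  Nothing weaker, nothing padded.
[cite: Deligne2000, §1] [cite: Milne1999, §7 p. 72] -/
theorem hc_cm_iff_cycleClause :
    HC_CM ↔ ∀ A : AbelianVariety ℂ, IsOfCMType A →
      ∀ (p : ℕ) (c : complexBetti A.X (2 * p)),
        IsRationalClass c → IsOfHodgeType A.dim A.X (2 * p) p p c → c ∈ algebraicClasses A.X p := by
  constructor
  · intro h A hCM p c hc hpp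
    exact (h A AbelianVariety.isSmoothProjective_holds hCM).2 p c hc hpp
  · intro h A hsp hCM
    obtain ⟨M, -⟩ := exists_isReal_hodgeModel_holds A.dim A.X hsp
    exact ⟨⟨M⟩, h A hCM⟩

/-- **Below dimension `4` the clause of `HC_CM` is a theorem of the tree**: the Hodge conjecture holds for every
complex abelian variety of dimension `≤ 3` (`hodgeConjectureFor_abelian_of_dim_le_three'`: `B = D` there, hard
Lefschetz + Lefschetz `(1,1)`), CM or not.  So all content of `HC_CM` sits in dimension `≥ 4`.
[cite: vanGeemen1994HodgeAV, §2.4–2.5 (p. 235)] -/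
theorem cmHodgeHypothesisAt_of_dim_le_three (A : AbelianVariety ℂ) (hA : A.dim ≤ 3) : CMHodgeHypothesisAt A :=
  fun _ _ => Literature.AlgebraicGeometry.HodgeTheory.hodgeConjectureFor_abelian_of_dim_le_three' A hA

/-- **`HC_CM` is exactly the algebraicity of EXCEPTIONAL Hodge classes on CM abelian varieties.**  Products of
divisor classes are algebraic on every complex abelian variety (`Dᵖ ⊗ ℂ ⊆ Nᵖ H²ᵖ`:
`AbelianVariety.divisorClassesSpan_le_algebraicClasses`, from Lefschetz `(1,1)`, the tree theorem
`lefschetzOneOne_rational_holds`), and a rational `(p,p)`-class outside `Dᵖ ⊗ ℂ` forces `2 ≤ p ≤ dim A − 2`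
(`AbelianVariety.two_le_and_add_two_le_dim_of_exceptional`, van Geemen 2.5).  Hence `HC_CM` is EQUIVALENT to:
for every complex abelian variety `A` of CM type and every `p` with `2 ≤ p`, `p + 2 ≤ dim A`, every rational
`(p,p)`-class in `H^{2p}(A(ℂ); ℂ)` NOT in the span of products of divisor classes is algebraic.  By
`exists_simple_cm_sixfold_exceptional` this clause quantifies over a NONEMPTY set of classes.
[cite: vanGeemen1994HodgeAV, §2.4–2.5 (p. 235)] [cite: Milne1999, §7 p. 72] -/
theorem hc_cm_iff_exceptionalClause :
    HC_CM ↔ ∀ A : AbelianVariety ℂ, IsOfCMType A → ∀ p : ℕ, 2 ≤ p → p + 2 ≤ A.dim →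
      ∀ c : complexBetti A.X (2 * p), IsRationalClass c → IsOfHodgeType A.dim A.X (2 * p) p p c →
        c ∉ divisorClassesSpan A.X A.dim p → c ∈ algebraicClasses A.X p := by
  rw [hc_cm_iff_cycleClause]
  constructor
  · intro h A hCM p _ _ c hc hpp _
    exact h A hCM p c hc hpp
  · intro h A hCM p c hc hpp
    by_cases hcD : c ∈ divisorClassesSpan A.X A.dim p
    · exact Literature.AlgebraicGeometry.HodgeTheory.AbelianVariety.divisorClassesSpan_le_algebraicClasses A
        (fun b hb hb' => lefschetzOneOne_rational_holds AbelianVariety.isSmoothProjective_holds b hb hb') p hcD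
    · obtain ⟨h2, hp2⟩ :=
        Literature.AlgebraicGeometry.HodgeTheory.two_le_and_add_two_le_dim_of_exceptional A hc hpp hcD
      exact h A hCM p h2 hp2 c hc hpp hcD

/-- **`HC_CM` has certified content**: it implies the algebraicity of an EXCEPTIONAL rational `(3,3)`-class on a
simple CM abelian sixfold (the one of `exists_simple_cm_sixfold_exceptional`) — a statement which is neither a
consequence of Lefschetz `(1,1)` (the class is outside `D³ ⊗ ℂ`) nor covered by the tree's low-dimension theorems
(`dim = 6`). [cite: Pohlmann1968, §3] [cite: vanGeemen1994HodgeAV, Thm. 4.5] -/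
theorem hc_cm_exceptional_instance (h : HC_CM) :
    ∃ A : AbelianVariety ℂ, A.IsSimple ∧ A.dim = 6 ∧ IsOfCMType A ∧
      ∃ c : complexBetti A.X (2 * 3), IsRationalClass c ∧ IsOfHodgeType A.dim A.X (2 * 3) 3 3 c ∧
        c ∉ divisorClassesSpan A.X A.dim 3 ∧ c ∈ algebraicClasses A.X 3 := by
  obtain ⟨A, hS, h6, hCM, c, hc, hpp, hcD⟩ := exists_simple_cm_sixfold_exceptional
  exact ⟨A, hS, h6, hCM, c, hc, hpp, hcD, hc_cm_iff_cycleClause.1 h A hCM 3 c hc hpp⟩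

/-- **`HC_CM` at the simple CM sixfold**: it yields the Hodge conjecture `HodgeConjectureFor 6 A.X` for an honest
simple CM abelian sixfold `A` (both binders discharged by theorems). [cite: Deligne2000, §1] -/
theorem hc_cm_apply_simple_sixfold (h : HC_CM) :
    ∃ A : AbelianVariety ℂ, IsSimpleCMSixfold A ∧ HodgeConjectureFor 6 A.X := by
  obtain ⟨A, hA⟩ := exists_simple_cm_sixfold
  refine ⟨A, hA, ?_⟩
  have h6 : A.dim = 6 := hA.1
  exact h6 ▸ h A AbelianVariety.isSmoothProjective_holds hA.2.2

/-! ### (T4) The E term's type, reduced to its two open leaves -/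

/-- **The type of the stage-2 E term has exactly two displayed leaves.**  In
`HC_CM_of_PerLFace := ∀ hHD hI h₁ h₃, (Model.picardCMUniverse hHD hI h₁ h₃).PerLFace → DeligneMilne1982_Thm_6_20_full
→ HC_CM` the binders `hHD : exists_isReal_hodgeModel`, `hI : hodgePQ_independent_of_hodgeModel`,
`h₃ : CMAbelianVarietyRealised` and the premise `hR : DeligneMilne1982_Thm_6_20_full` range over propositions that are
THEOREMS of the tree (`exists_isReal_hodgeModel_holds`, `hodgePQ_independent_of_hodgeModel_holds`,
`cmAbelianVarietyRealised_holds`, `deligneMilne1982_Thm_6_20_full_holds`); by proof irrelevance every instance of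
the model universe `Model.picardCMUniverse hHD hI h₁ h₃` is definitionally the one built on those theorems, so the
E term's type is EQUIVALENT to «for every uniformisation record `h₁ : BallQuotientUniformised`, the face-form period
theorem of THAT model universe implies `HC_CM`».  The two remaining leaves — `h₁` and `PerLFace` of the model
universe — are not touched here. [folklore] -/
theorem hc_cm_of_PerLFace_iff_two_leaves :
    HC_CM_of_PerLFace ↔
      ∀ h₁ : BallQuotientUniformised,
        (Model.picardCMUniverse exists_isReal_hodgeModel_holds hodgePQ_independent_of_hodgeModel_holds h₁
            cmAbelianVarietyRealised_holds).PerLFace → HC_CM := by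
  constructor
  · intro h h₁ hP
    exact h exists_isReal_hodgeModel_holds hodgePQ_independent_of_hodgeModel_holds h₁
      cmAbelianVarietyRealised_holds hP deligneMilne1982_Thm_6_20_full_holds
  · intro h hHD hI h₁ h₃ hP _hR
    exact h h₁ hP

/-- **The E term of record, displayed padding-free**: from `hc_cm_of_PerLFace` (p238778), for every uniformisation
record `h₁`, the face-form period theorem of the model universe of record implies that every rational
`(p,p)`-class on every complex abelian variety of CM type is algebraic (`hc_cm_iff_cycleClause`).  (An APPLICATION
of the E term of record; no new constant of type `HC_CM_of_PerLFace`.) [folklore] -/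
theorem cycleClause_of_PerLFace (h₁ : BallQuotientUniformised)
    (hP : (Model.picardCMUniverse exists_isReal_hodgeModel_holds hodgePQ_independent_of_hodgeModel_holds h₁
      cmAbelianVarietyRealised_holds).PerLFace)
    (A : AbelianVariety ℂ) (hA : IsOfCMType A) (p : ℕ) (c : complexBetti A.X (2 * p))
    (hc : IsRationalClass c) (hpp : IsOfHodgeType A.dim A.X (2 * p) p p c) :
    c ∈ algebraicClasses A.X p :=
  hc_cm_iff_cycleClause.1 (hc_cm_of_PerLFace_iff_two_leaves.1 hc_cm_of_PerLFace h₁ hP) A hA p c hc hpp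

/-- **… in particular the exceptional `(3,3)`-class of `exists_simple_cm_sixfold_exceptional` becomes algebraic**:
the E term of record, under its two open leaves, decides a class that no tree theorem decides. [folklore] -/
theorem exceptional_algebraic_of_PerLFace (h₁ : BallQuotientUniformised)
    (hP : (Model.picardCMUniverse exists_isReal_hodgeModel_holds hodgePQ_independent_of_hodgeModel_holds h₁
      cmAbelianVarietyRealised_holds).PerLFace) :
    ∃ A : AbelianVariety ℂ, A.IsSimple ∧ A.dim = 6 ∧ IsOfCMType A ∧
      ∃ c : complexBetti A.X (2 * 3), IsRationalClass c ∧ IsOfHodgeType A.dim A.X (2 * 3) 3 3 c ∧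
        c ∉ divisorClassesSpan A.X A.dim 3 ∧ c ∈ algebraicClasses A.X 3 :=
  hc_cm_exceptional_instance (hc_cm_of_PerLFace_iff_two_leaves.1 hc_cm_of_PerLFace h₁ hP)

end Summit.HodgeConjecture.CorCM

end
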